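import Summits.Ventures.PercRepro.C041TriangleLeafStar3Coord0
import Summits.Ventures.PercRepro.C041TriangleLeafStar3Coord1
import Summits.Ventures.PercRepro.C041TriangleLeafStar3Coord2
import Summits.Ventures.PercRepro.C041TriangleLeafStar3Coord3
import Summits.Ventures.PercRepro.C041TriangleLeafStar3Coord4
import Summits.Ventures.PercRepro.C041TriangleLeafStar3Coord5

/-!
# THEOREM (LEAF × THREE-LEAF STAR) — `θ_△(v d, v a * v b * v c) ∈ cone` for all variables in `[0, 1]` (mine-3, gen 67; C-041.md §21 (bg))

The certificate is the exact Bernstein-quadratic identity `thetaTri_leafStar3_eq`: `θ_△(v d, v a * v b * v c) = leafStar3A a b c d + leafStar3B a b c d + leafStar3C a b c d + leafStar3D a b c d + leafStar3E a b c d + leafStar3F a b c d + leafStar3G a b c d + leafStar3H a b c d + leafStar3I a b c d + leafStar3J a b c d + leafStar3K a b c d + leafStar3L a b c d` (an exact kit-LP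
vertex: 141 generators, 1630 terms, HiGHS support search + exact rational re-solve, re-verified exactly by
tools/g67/gen_cert.py before emission), checked coordinate by coordinate by `ring`; each part is a cone element (every
coefficient a non-negative combination of Bernstein-quadratic monomials, every generator a product of at most two
leaves at atoms in `[0, 1]`).
-/

namespace PercRepro

namespace RelaxedTriangle

open TreeClosure

/-- **THE IDENTITY**: `θ_△(v d, v a * v b * v c) = leafStar3A a b c d + leafStar3B a b c d + leafStar3C a b c d + leafStar3D a b c d + leafStar3E a b c d + leafStar3F a b c d + leafStar3G a b c d + leafStar3H a b c d + leafStar3I a b c d + leafStar3J a b c d + leafStar3K a b c d + leafStar3L a b c d`. -/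
theorem thetaTri_leafStar3_eq (a b c d : ℝ) :
    thetaTri (v d) (v a * v b * v c) = leafStar3A a b c d + leafStar3B a b c d + leafStar3C a b c d + leafStar3D a b c d + leafStar3E a b c d + leafStar3F a b c d + leafStar3G a b c d + leafStar3H a b c d + leafStar3I a b c d + leafStar3J a b c d + leafStar3K a b c d + leafStar3L a b c d := by
  ext i
  fin_cases i
  · exact thetaTri_leafStar3_coord0 a b c d
  · exact thetaTri_leafStar3_coord1 a b c d
  · exact thetaTri_leafStar3_coord2 a b c d
  · exact thetaTri_leafStar3_coord3 a b c d
  · exact thetaTri_leafStar3_coord4 a b c d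
  · exact thetaTri_leafStar3_coord5 a b c d

/-- **THEOREM (LEAF × THREE-LEAF STAR)**: `θ_△(v d, v a * v b * v c) ∈ cone` for all variables in `[0, 1]`. -/
theorem InCone_thetaTri_leafStar3 (a b c d : ℝ) (ha : 0 ≤ a ∧ a ≤ 1) (hb : 0 ≤ b ∧ b ≤ 1) (hc : 0 ≤ c ∧ c ≤ 1) (hd : 0 ≤ d ∧ d ≤ 1) :
    InCone (thetaTri (v d) (v a * v b * v c)) := by
  rw [thetaTri_leafStar3_eq]
  exact ((((((((((((InCone_leafStar3A a b c d ha hb hc hd).add (InCone_leafStar3B a b c d ha hb hc hd)).add (InCone_leafStar3C a b c d ha hb hc hd)).add (InCone_leafStar3D a b c d ha hb hc hd)).add (InCone_leafStar3E a b c d ha hb hc hd)).add (InCone_leafStar3F a b c d ha hb hc hd)).add (InCone_leafStar3G a b c d ha hb hc hd)).add (InCone_leafStar3H a b c d ha hb hc hd)).add (InCone_leafStar3I a b c d ha hb hc hd)).add (InCone_leafStar3J a b c d ha hb hc hd)).add (InCone_leafStar3K a b c d ha hb hc hd)).add (InCone_leafStar3L a b c d ha hb hc hd))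

end RelaxedTriangle

end PercRepro
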